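import Summits.FinalStateConjecture.FinalStateConjecture.Theorems.SwallowTheDatumParametricKerrBurialStubChargeBound
import Summits.FinalStateConjecture.FinalStateConjecture.Theorems.SwallowTheDatumUniversalWitnessFamilyStubPlugDataPlusFromOfAux2
import Mathlib.MeasureTheory.Function.LocallyIntegrable

/-!
# `ParametricKerrBurial`, line `receding-annulus-universal-collar` — stub `stub_siteMargin` (BK1), helper file 2:
# perturbation of the OUT field at radius `32` (crux item stmt-FinalStateConjecture-10052)

The registered stub `stub_siteMargin` (file `SwallowTheDatumParametricKerrBurialStubSiteMargin.lean`) reads an OUT metric field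
`gOut` which is only `C^∞` on `{16 < ‖x‖}` and `C²`-close on `{32 ≤ ‖x‖ ≤ 64}` to the exact Schwarzschild field.  This file is the
radius-`32` perturbation theory of the η-averaged charges `E, C` of Mao–Oh–Tao (arXiv:2308.13031, §1.2, (1.3), (1.5), (1.7);
tree: `MaoOhTao.avgE/avgC`, `ObstructionFreeGluing.lean`) for fields that are merely `C¹` ON `{16 < ‖x‖}` (everything proved):

* integrability of the `E`- and `C`-integrands at radius `32` (they are continuous on `{16 < ‖x‖}` and the weight `η_32`
  vanishes off the compact annulus `{32 ≤ ‖x‖ ≤ 64}`), hence ADDITIVITY: `Q[g; A_32] − Q[g′; A_32] = Q[g − g′ + δ; A_32]`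
  for `Q = E, C_l` (`sm_avgE32_sub`, `sm_avgC32_sub`);
* the radius-`32` analogue of lead c1's `stub_chargeBound` with LOCAL smoothness: `|E[q; A_32]| ≤ 18 s ∫|η_32(|x|)|dx`,
  `|C_l[q; A_32]| ≤ 1170 s ∫|η_32(|x|)|dx` whenever `DevLE q k 32 64 s` and `q ∈ C¹({16 < ‖x‖})` (`sm_abs_avgE32_le`,
  `sm_abs_avgC32_le`; the elementary bounds `cb_*` of `…StubChargeBound.lean` are reused).

References: Mao–Oh–Tao 2023, §1.2 (the charges are linear functionals of `(g − δ, k)`).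
-/

set_option linter.dupNamespace false
-- the operator norm on `E3 [×m]→L[ℝ] (E3 →L[ℝ] E3 →L[ℝ] ℝ)` needs a longer instance search than the default budget
set_option synthInstance.maxHeartbeats 120000

noncomputable section

-- instance search through the nested operator types `E3 →L E3 →L ℝ`
set_option maxSynthPendingDepth 3

namespace Summit.FinalStateConjecture.FinalStateConjecture.Theorems.SwallowTheDatum.ParametricKerrBurial

open scoped ContDiff Topology BigOperators InnerProductSpace
open Set Filter Function MeasureTheory Literature.Geometry.Lorentzian
open Literature.Geometry.Lorentzian.MaoOhTao
open Summit.FinalStateConjecture.FinalStateConjecture.Theorems.SwallowTheDatum.UniversalWitnessFamily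

/-! ## Perturbation at radius `32`: integrability, additivity, local charge bounds -/

section Perturbation

variable {η : ℝ → ℝ} {g g' q k : E3 → E3 →L[ℝ] E3 →L[ℝ] ℝ}

/-- The exterior region `{16 < ‖x‖}` is open. [folklore] -/
theorem sm_isOpen_outer16 : IsOpen {x : E3 | 16 < ‖x‖} := isOpen_lt continuous_const continuous_norm

/-- The closed annulus `{32 ≤ ‖x‖ ≤ 64}` is compact. [folklore] -/
theorem sm_isCompact_annulus32 : IsCompact ({y : E3 | 32 ≤ ‖y‖} ∩ {y : E3 | ‖y‖ ≤ 64}) :=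
  (isCompact_closedBall (0 : E3) 64).of_isClosed_subset
    ((isClosed_le continuous_const continuous_norm).inter (isClosed_le continuous_norm continuous_const))
    fun _ hy ↦ mem_closedBall_zero_iff.2 hy.2

/-- The radial weight `η_r(|x|)` of an admissible bump is continuous on `ℝ³`. [cite: MaoOhTao2023, §1.2 (1.7)] -/
theorem sm_continuous_wt (hη : IsBump η) (r : ℝ) : Continuous (wt η r) := by
  show Continuous fun x : E3 ↦ r⁻¹ * η (‖x‖ / r)
  exact continuous_const.mul (hη.1.continuous.comp (continuous_norm.div_const r))

/-- A field `C¹` on `{16 < ‖x‖}` is differentiable at every point of that region. [folklore] -/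
theorem sm_differentiableAt (hg : ContDiffOn ℝ 1 g {x : E3 | 16 < ‖x‖}) {x : E3} (hx : 16 < ‖x‖) :
    DifferentiableAt ℝ g x :=
  (hg.differentiableOn one_ne_zero).differentiableAt (sm_isOpen_outer16.mem_nhds hx)

/-- The components of a field `C¹` on `{16 < ‖x‖}` are differentiable there. [folklore] -/
theorem sm_differentiableAt_cmp (hg : ContDiffOn ℝ 1 g {x : E3 | 16 < ‖x‖}) {x : E3} (hx : 16 < ‖x‖)
    (i j : Fin 3) : DifferentiableAt ℝ (cmp g i j) x := by
  unfold MaoOhTao.cmp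
  exact ((sm_differentiableAt hg hx).clm_apply (differentiableAt_const _)).clm_apply
    (differentiableAt_const _)

/-- The components of a field `C¹` on `{16 < ‖x‖}` are continuous there. [folklore] -/
theorem sm_continuousOn_cmp (hg : ContDiffOn ℝ 1 g {x : E3 | 16 < ‖x‖}) (i j : Fin 3) :
    ContinuousOn (cmp g i j) {x : E3 | 16 < ‖x‖} := by
  unfold MaoOhTao.cmp
  exact (hg.continuousOn.clm_apply continuousOn_const).clm_apply continuousOn_const

/-- The coordinate partials of the components of a field `C¹` on `{16 < ‖x‖}` are continuous there.
[folklore] -/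
theorem sm_continuousOn_pd_cmp (hg : ContDiffOn ℝ 1 g {x : E3 | 16 < ‖x‖}) (l i j : Fin 3) :
    ContinuousOn (pd l (cmp g i j)) {x : E3 | 16 < ‖x‖} := by
  have h1 : ContDiffOn ℝ 1 (cmp g i j) {x : E3 | 16 < ‖x‖} := by
    unfold MaoOhTao.cmp
    exact (hg.clm_apply contDiffOn_const).clm_apply contDiffOn_const
  have h2 := h1.continuousOn_fderiv_of_isOpen sm_isOpen_outer16 le_rfl
  show ContinuousOn (fun x ↦ fderiv ℝ (cmp g i j) x (e l)) {x : E3 | 16 < ‖x‖}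
  exact h2.clm_apply continuousOn_const

/-- The direction cosines `x^j/|x|` are continuous on `{16 < ‖x‖}`. [folklore] -/
theorem sm_continuousOn_dir (j : Fin 3) : ContinuousOn (fun x : E3 ↦ x j / ‖x‖) {x : E3 | 16 < ‖x‖} :=
  (EuclideanSpace.proj (𝕜 := ℝ) j).continuous.continuousOn.div continuous_norm.continuousOn
    fun x hx ↦ (lt_trans (by norm_num) (show (16 : ℝ) < ‖x‖ from hx)).ne'

/-- **Integrability of a weighted integrand**: `η_32(|x|) Φ(x)` is integrable on `ℝ³` as soon as `Φ` is continuous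
on `{16 < ‖x‖}` (the weight is continuous and vanishes off the compact annulus `{32 ≤ ‖x‖ ≤ 64}`). [folklore] -/
theorem sm_integrable_wt_mul (hη : IsBump η) {Φ : E3 → ℝ} (hΦ : ContinuousOn Φ {x : E3 | 16 < ‖x‖}) :
    Integrable fun x : E3 ↦ wt η 32 x * Φ x := by
  have hKU : ({y : E3 | 32 ≤ ‖y‖} ∩ {y : E3 | ‖y‖ ≤ 64}) ⊆ {x : E3 | 16 < ‖x‖} :=
    fun y hy ↦ lt_of_lt_of_le (by norm_num) (show (32 : ℝ) ≤ ‖y‖ from hy.1)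
  have hc : ContinuousOn (fun x : E3 ↦ wt η 32 x * Φ x) ({y : E3 | 32 ≤ ‖y‖} ∩ {y : E3 | ‖y‖ ≤ 64}) :=
    ((sm_continuous_wt hη 32).continuousOn.mul hΦ).mono hKU
  refine (hc.integrableOn_compact sm_isCompact_annulus32).integrable_of_forall_notMem_eq_zero
    fun x hx ↦ ?_
  have hx' : ¬(32 < ‖x‖ ∧ ‖x‖ < 2 * 32) := fun h ↦ hx ⟨h.1.le, by
    show ‖x‖ ≤ 64
    linarith [h.2]⟩
  rw [PlugDataPlus.wt_eq_zero_of_not_mem hη (by norm_num) hx', zero_mul]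

/-- The energy integrand at radius `32` of a field `C¹` on `{16 < ‖x‖}` is integrable.
[cite: MaoOhTao2023, §1.2 (1.3), (1.7)] -/
theorem sm_integrable_intE (hη : IsBump η) (hg : ContDiffOn ℝ 1 g {x : E3 | 16 < ‖x‖}) :
    Integrable fun x : E3 ↦ wt η 32 x *
      ∑ i, ∑ j, (pd i (cmp g i j) x - pd j (cmp g i i) x) * (x j / ‖x‖) :=
  sm_integrable_wt_mul hη (continuousOn_finsetSum _ fun i _ ↦ continuousOn_finsetSum _ fun j _ ↦
    ((sm_continuousOn_pd_cmp hg i i j).sub (sm_continuousOn_pd_cmp hg j i i)).mul (sm_continuousOn_dir j))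

/-- The centre-of-mass integrand at radius `32` of a field `C¹` on `{16 < ‖x‖}` is integrable.
[cite: MaoOhTao2023, §1.2 (1.5), (1.7)] -/
theorem sm_integrable_intC (hη : IsBump η) (hg : ContDiffOn ℝ 1 g {x : E3 | 16 < ‖x‖}) (l : Fin 3) :
    Integrable fun x : E3 ↦ wt η 32 x * ∑ i, ∑ j,
      (x l * pd i (cmp g i j) x - x l * pd j (cmp g i i) x
        - (if i = l then cmp g i j x - (if i = j then 1 else 0) else 0)
        + (if j = l then cmp g i i x - 1 else 0)) * (x j / ‖x‖) := by
  have hite : ∀ (P : Prop) [Decidable P] (f : E3 → ℝ), ContinuousOn f {x : E3 | 16 < ‖x‖} →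
      ContinuousOn (fun x ↦ if P then f x else 0) {x : E3 | 16 < ‖x‖} := by
    intro P _ f hf
    by_cases hP : P
    · simp only [if_pos hP]
      exact hf
    · simp only [if_neg hP]
      exact continuousOn_const
  have hxl : ContinuousOn (fun x : E3 ↦ x l) {x : E3 | 16 < ‖x‖} :=
    (EuclideanSpace.proj (𝕜 := ℝ) l).continuous.continuousOn
  refine sm_integrable_wt_mul hη
    (continuousOn_finsetSum _ fun i _ ↦ continuousOn_finsetSum _ fun j _ ↦ ?_)
  exact ((((hxl.mul (sm_continuousOn_pd_cmp hg i i j)).sub (hxl.mul (sm_continuousOn_pd_cmp hg j i i))).sub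
    (hite _ _ ((sm_continuousOn_cmp hg i j).sub continuousOn_const))).add
    (hite _ _ ((sm_continuousOn_cmp hg i i).sub continuousOn_const))).mul (sm_continuousOn_dir j)

/-- Components of the perturbation field `g − g′ + δ`: `g_{ij} − g′_{ij} + δ_{ij}`. [folklore] -/
theorem sm_cmp_pert (g g' : E3 → E3 →L[ℝ] E3 →L[ℝ] ℝ) (i j : Fin 3) (x : E3) :
    cmp (fun y ↦ g y - g' y + (innerSL ℝ : E3 →L[ℝ] E3 →L[ℝ] ℝ)) i j x =
      cmp g i j x - cmp g' i j x + (if i = j then 1 else 0) := by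
  rw [← PlugDataPlus.cmp_flat i j x]
  simp only [MaoOhTao.cmp, _root_.add_apply, _root_.sub_apply]

/-- Partials of the components of the perturbation field on `{16 < ‖x‖}`: `∂_l(g − g′ + δ)_{ij} = ∂_l g_{ij} − ∂_l g′_{ij}`
for `g, g′ ∈ C¹({16 < ‖x‖})`. [folklore] -/
theorem sm_pd_cmp_pert (hg : ContDiffOn ℝ 1 g {x : E3 | 16 < ‖x‖}) (hg' : ContDiffOn ℝ 1 g' {x : E3 | 16 < ‖x‖})
    {x : E3} (hx : 16 < ‖x‖) (l i j : Fin 3) :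
    pd l (cmp (fun y ↦ g y - g' y + (innerSL ℝ : E3 →L[ℝ] E3 →L[ℝ] ℝ)) i j) x =
      pd l (cmp g i j) x - pd l (cmp g' i j) x := by
  have hc : cmp (fun y ↦ g y - g' y + (innerSL ℝ : E3 →L[ℝ] E3 →L[ℝ] ℝ)) i j =
      fun y ↦ (cmp g i j y - cmp g' i j y) + (if i = j then (1 : ℝ) else 0) :=
    funext fun y ↦ sm_cmp_pert g g' i j y
  rw [hc]
  unfold pd
  rw [fderiv_add_const,
    fderiv_fun_sub (sm_differentiableAt_cmp hg hx i j) (sm_differentiableAt_cmp hg' hx i j),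
    _root_.sub_apply]

/-- **Additivity of the averaged energy at radius `32`** for fields `C¹` on `{16 < ‖x‖}`:
`E[g; A_32] − E[g′; A_32] = E[g − g′ + δ; A_32]` (the charge is a linear functional of `g − δ`; integrability of the
integrands and additivity of `∂` on differentiable functions). [cite: MaoOhTao2023, §1.2 (1.3)] -/
theorem sm_avgE32_sub (hη : IsBump η) (hg : ContDiffOn ℝ 1 g {x : E3 | 16 < ‖x‖})
    (hg' : ContDiffOn ℝ 1 g' {x : E3 | 16 < ‖x‖}) :
    avgE η 32 g - avgE η 32 g' = avgE η 32 (fun y ↦ g y - g' y + (innerSL ℝ : E3 →L[ℝ] E3 →L[ℝ] ℝ)) := by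
  unfold avgE
  rw [← mul_sub, ← integral_sub (sm_integrable_intE hη hg) (sm_integrable_intE hη hg')]
  congr 1
  refine integral_congr_ae (Eventually.of_forall fun x ↦ ?_)
  by_cases hx : 32 < ‖x‖ ∧ ‖x‖ < 2 * 32
  · have hx16 : 16 < ‖x‖ := by linarith [hx.1]
    simp only [sm_pd_cmp_pert hg hg' hx16]
    rw [← mul_sub, ← Finset.sum_sub_distrib]
    congr 1
    refine Finset.sum_congr rfl fun i _ ↦ ?_
    rw [← Finset.sum_sub_distrib]
    exact Finset.sum_congr rfl fun j _ ↦ by ring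
  · simp only [PlugDataPlus.wt_eq_zero_of_not_mem hη (by norm_num : (0 : ℝ) < 32) hx, zero_mul, sub_zero]

/-- **Additivity of the averaged centre of mass at radius `32`** for fields `C¹` on `{16 < ‖x‖}`:
`C_l[g; A_32] − C_l[g′; A_32] = C_l[g − g′ + δ; A_32]`. [cite: MaoOhTao2023, §1.2 (1.5)] -/
theorem sm_avgC32_sub (hη : IsBump η) (hg : ContDiffOn ℝ 1 g {x : E3 | 16 < ‖x‖})
    (hg' : ContDiffOn ℝ 1 g' {x : E3 | 16 < ‖x‖}) (l : Fin 3) :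
    avgC η 32 g l - avgC η 32 g' l =
      avgC η 32 (fun y ↦ g y - g' y + (innerSL ℝ : E3 →L[ℝ] E3 →L[ℝ] ℝ)) l := by
  unfold avgC
  rw [← mul_sub, ← integral_sub (sm_integrable_intC hη hg l) (sm_integrable_intC hη hg' l)]
  congr 1
  refine integral_congr_ae (Eventually.of_forall fun x ↦ ?_)
  by_cases hx : 32 < ‖x‖ ∧ ‖x‖ < 2 * 32
  · have hx16 : 16 < ‖x‖ := by linarith [hx.1]
    simp only [sm_pd_cmp_pert hg hg' hx16, sm_cmp_pert, if_true]
    rw [← mul_sub, ← Finset.sum_sub_distrib]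
    congr 1
    refine Finset.sum_congr rfl fun i _ ↦ ?_
    rw [← Finset.sum_sub_distrib]
    refine Finset.sum_congr rfl fun j _ ↦ ?_
    split_ifs <;> ring
  · simp only [PlugDataPlus.wt_eq_zero_of_not_mem hη (by norm_num : (0 : ℝ) < 32) hx, zero_mul, sub_zero]

/-- The coordinate derivative of a component of a field differentiable at the point is the component of the
Fréchet derivative: `∂_l g_{ij}(x) = (Dg(x) e_l)(e_i, e_j)`. [folklore] -/
theorem sm_pd_cmp_of_differentiableAt {x : E3} (hg : DifferentiableAt ℝ g x) (l i j : Fin 3) :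
    pd l (cmp g i j) x = fderiv ℝ g x (e l) (e i) (e j) := by
  obtain ⟨A, hA⟩ : ∃ A : (E3 →L[ℝ] E3 →L[ℝ] ℝ) →L[ℝ] ℝ, ∀ B, A B = B (e i) (e j) :=
    ⟨(ContinuousLinearMap.apply ℝ ℝ (e j)).comp (ContinuousLinearMap.apply ℝ (E3 →L[ℝ] ℝ) (e i)),
      fun B ↦ rfl⟩
  have hcmp : cmp g i j = ⇑A ∘ g := funext fun y ↦ (hA (g y)).symm
  have hd : HasFDerivAt (⇑A ∘ g) (A.comp (fderiv ℝ g x)) x := A.hasFDerivAt.comp x hg.hasFDerivAt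
  rw [pd, hcmp, hd.fderiv, ContinuousLinearMap.comp_apply, hA]

/-- On `{‖x‖ ≤ 64}` every Cartesian coordinate is bounded by `64`. [folklore] -/
theorem sm_abs_coord_le {x : E3} (hx : ‖x‖ ≤ 64) (j : Fin 3) : |x j| ≤ 64 :=
  ((Real.norm_eq_abs _).symm.trans_le (PiLp.norm_apply_le x j)).trans hx

/-- **On-shell consequences of `DevLE q k 32 64 s`** at a point `x` of the closed shell where `q` is differentiable:
`|q_{ij} − δ_{ij}| ≤ s`, `|∂_l q_{ij}| ≤ s`. [folklore] -/
theorem sm_shell32_bounds {s : ℝ} (hdev : DevLE q k 32 64 s) {x : E3} (hd : DifferentiableAt ℝ q x)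
    (h1 : 32 ≤ ‖x‖) (h2 : ‖x‖ ≤ 64) :
    (∀ i j, |cmp q i j x - (if i = j then 1 else 0)| ≤ s) ∧ (∀ l i j, |pd l (cmp q i j) x| ≤ s) := by
  obtain ⟨hG, -⟩ := hdev x h1 h2
  have h0 : ‖q x - (innerSL ℝ : E3 →L[ℝ] E3 →L[ℝ] ℝ)‖ ≤ s := by
    have h' := hG 0 (by norm_num)
    rwa [norm_iteratedFDeriv_zero] at h'
  have h1' : ‖fderiv ℝ q x‖ ≤ s := by
    have h' := hG 1 (by norm_num)
    rwa [norm_iteratedFDeriv_one, fderiv_sub_const] at h'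
  refine ⟨fun i j ↦ ?_, fun l i j ↦ ?_⟩
  · rw [← cb_sub_innerSL_apply]
    exact (cb_abs_apply₂_le_norm _ i j).trans h0
  · rw [sm_pd_cmp_of_differentiableAt hd]
    calc |fderiv ℝ q x (e l) (e i) (e j)| ≤ ‖fderiv ℝ q x (e l)‖ := cb_abs_apply₂_le_norm _ i j
      _ ≤ ‖fderiv ℝ q x‖ * ‖e l‖ := ContinuousLinearMap.le_opNorm _ _
      _ ≤ s := by rw [show ‖e l‖ = 1 by simp [e], mul_one]; exact h1'

/-- **The integral estimate at radius `32`**: if `|F(x)| ≤ |η_32(|x|)| · B` pointwise then `|∫ F| ≤ (∫ |η_32(|x|)| dx) · B`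
(the bound is continuous with support in the closed ball of radius `64`; `MeasureTheory.norm_integral_le_of_norm_le`).
[folklore] -/
theorem sm_abs_integral_le (hη : IsBump η) {F : E3 → ℝ} {B : ℝ}
    (h : ∀ x, |F x| ≤ |wt η 32 x| * B) : |∫ x, F x| ≤ (∫ x : E3, |wt η 32 x|) * B := by
  have hcont : Continuous fun x : E3 ↦ |wt η 32 x| * B := (sm_continuous_wt hη 32).abs.mul continuous_const
  have hsupp : HasCompactSupport fun x : E3 ↦ |wt η 32 x| * B := by
    refine HasCompactSupport.intro (isCompact_closedBall (0 : E3) 64) fun x hx ↦ ?_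
    rw [mem_closedBall_zero_iff, not_le] at hx
    have hx' : ¬(32 < ‖x‖ ∧ ‖x‖ < 2 * 32) := fun h' ↦ by linarith [h'.2]
    simp [PlugDataPlus.wt_eq_zero_of_not_mem hη (by norm_num : (0 : ℝ) < 32) hx']
  have hint : Integrable (fun x : E3 ↦ |wt η 32 x| * B) := hcont.integrable_of_hasCompactSupport hsupp
  calc |∫ x, F x| = ‖∫ x, F x‖ := (Real.norm_eq_abs _).symm
    _ ≤ ∫ x : E3, |wt η 32 x| * B :=
        norm_integral_le_of_norm_le hint (Eventually.of_forall fun x ↦ by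
          rw [Real.norm_eq_abs]; exact h x)
    _ = (∫ x : E3, |wt η 32 x|) * B := integral_mul_const _ _

/-- **Energy bound at radius `32`**: `|E[q; A_32]| ≤ 18 s ∫|η_32(|x|)| dx` for `q ∈ C¹({16 < ‖x‖})` with
`DevLE q k 32 64 s` (the radius-`32` analogue of `stub_chargeBound`). [cite: MaoOhTao2023, §1.2 (1.3)] -/
theorem sm_abs_avgE32_le (hη : IsBump η) {s : ℝ} (hq : ContDiffOn ℝ 1 q {x : E3 | 16 < ‖x‖}) (hs : 0 ≤ s)
    (hdev : DevLE q k 32 64 s) : |avgE η 32 q| ≤ (∫ x : E3, |wt η 32 x|) * (18 * s) := by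
  unfold avgE
  have key : ∀ x : E3, |wt η 32 x * ∑ i, ∑ j, (pd i (cmp q i j) x - pd j (cmp q i i) x) * (x j / ‖x‖)|
      ≤ |wt η 32 x| * (18 * s) := by
    intro x
    rw [abs_mul]
    by_cases hx : 32 < ‖x‖ ∧ ‖x‖ < 2 * 32
    · obtain ⟨-, hpd⟩ := sm_shell32_bounds hdev (sm_differentiableAt hq (by linarith [hx.1]))
        hx.1.le (by linarith [hx.2])
      refine mul_le_mul_of_nonneg_left ?_ (abs_nonneg _)
      calc _ ≤ 9 * (2 * s) := cb_abs_sum33_le fun i j ↦ ?_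
        _ = 18 * s := by ring
      calc _ ≤ s + s := cb_abs_mul_dir_le (cb_abs_sub_le (hpd i i j) (hpd j i i)) x j
        _ = 2 * s := by ring
    · rw [PlugDataPlus.wt_eq_zero_of_not_mem hη (by norm_num : (0 : ℝ) < 32) hx, abs_zero, zero_mul,
        zero_mul]
  have hI := sm_abs_integral_le hη key
  have hnn : 0 ≤ (∫ x : E3, |wt η 32 x|) * (18 * s) :=
    mul_nonneg (integral_nonneg fun _ ↦ abs_nonneg _) (by positivity)
  rw [abs_mul, abs_of_pos (by norm_num : (0 : ℝ) < 1 / 2)]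
  linarith

/-- **Centre-of-mass bound at radius `32`**: `|C_l[q; A_32]| ≤ 1170 s ∫|η_32(|x|)| dx` for `q ∈ C¹({16 < ‖x‖})` with
`DevLE q k 32 64 s`. [cite: MaoOhTao2023, §1.2 (1.5)] -/
theorem sm_abs_avgC32_le (hη : IsBump η) {s : ℝ} (hq : ContDiffOn ℝ 1 q {x : E3 | 16 < ‖x‖}) (hs : 0 ≤ s)
    (hdev : DevLE q k 32 64 s) (l : Fin 3) :
    |avgC η 32 q l| ≤ (∫ x : E3, |wt η 32 x|) * (1170 * s) := by
  unfold avgC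
  have key : ∀ x : E3, |wt η 32 x * ∑ i, ∑ j,
      (x l * pd i (cmp q i j) x - x l * pd j (cmp q i i) x
        - (if i = l then cmp q i j x - (if i = j then 1 else 0) else 0)
        + (if j = l then cmp q i i x - 1 else 0)) * (x j / ‖x‖)| ≤ |wt η 32 x| * (1170 * s) := by
    intro x
    rw [abs_mul]
    by_cases hx : 32 < ‖x‖ ∧ ‖x‖ < 2 * 32
    · have hx2 : ‖x‖ ≤ 64 := by linarith [hx.2]
      obtain ⟨hc, hpd⟩ := sm_shell32_bounds hdev (sm_differentiableAt hq (by linarith [hx.1])) hx.1.le hx2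
      refine mul_le_mul_of_nonneg_left ?_ (abs_nonneg _)
      calc _ ≤ 9 * (130 * s) := cb_abs_sum33_le fun i j ↦ ?_
        _ = 1170 * s := by ring
      have hA : |x l * pd i (cmp q i j) x| ≤ 64 * s := by
        rw [abs_mul]
        exact mul_le_mul (sm_abs_coord_le hx2 l) (hpd i i j) (abs_nonneg _) (by norm_num)
      have hB : |x l * pd j (cmp q i i) x| ≤ 64 * s := by
        rw [abs_mul]
        exact mul_le_mul (sm_abs_coord_le hx2 l) (hpd j i i) (abs_nonneg _) (by norm_num)
      have hC : |(if i = l then cmp q i j x - (if i = j then 1 else 0) else 0)| ≤ s := by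
        by_cases hil : i = l
        · rw [if_pos hil]; exact hc i j
        · rw [if_neg hil, abs_zero]; exact hs
      have hD : |(if j = l then cmp q i i x - 1 else 0)| ≤ s := by
        by_cases hjl : j = l
        · rw [if_pos hjl]; simpa using hc i i
        · rw [if_neg hjl, abs_zero]; exact hs
      calc _ ≤ 64 * s + 64 * s + s + s :=
            cb_abs_mul_dir_le (cb_abs_add_le (cb_abs_sub_le (cb_abs_sub_le hA hB) hC) hD) x j
        _ = 130 * s := by ring
    · rw [PlugDataPlus.wt_eq_zero_of_not_mem hη (by norm_num : (0 : ℝ) < 32) hx, abs_zero, zero_mul,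
        zero_mul]
  have hI := sm_abs_integral_le hη key
  have hnn : 0 ≤ (∫ x : E3, |wt η 32 x|) * (1170 * s) :=
    mul_nonneg (integral_nonneg fun _ ↦ abs_nonneg _) (by positivity)
  rw [abs_mul, abs_of_pos (by norm_num : (0 : ℝ) < 1 / 2)]
  linarith

end Perturbation

/-! ## Anchor -/

/-- **Anchor of this helper file** (registered sub-goal `stub_siteMarginAux2_anchor` of item 10052): additivity of the averaged
energy at radius `32` for fields `C¹` on `{16 < ‖x‖}` (`sm_avgE32_sub`). [cite: MaoOhTao2023, §1.2 (1.3)] -/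
theorem stub_siteMarginAux2_anchor : ∀ (η : ℝ → ℝ) (g g' : E3 → E3 →L[ℝ] E3 →L[ℝ] ℝ), IsBump η → ContDiffOn ℝ 1 g {x : E3 | 16 < ‖x‖} → ContDiffOn ℝ 1 g' {x : E3 | 16 < ‖x‖} → avgE η 32 g - avgE η 32 g' = avgE η 32 (fun y ↦ g y - g' y + (innerSL ℝ : E3 →L[ℝ] E3 →L[ℝ] ℝ)) :=
  fun _ _ _ hη hg hg' ↦ sm_avgE32_sub hη hg hg'

end Summit.FinalStateConjecture.FinalStateConjecture.Theorems.SwallowTheDatum.ParametricKerrBurial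

end
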